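import Summits.HodgeConjecture.CorCM.B01.Transposition.Item6PlacementJunctionAppendixCRecords
import Summits.HodgeConjecture.HodgeCM.Model.ToyG2.LevelExists
import HarnessLib

/-!
# Δ2 junctions RESTRICTED TO THE GOOD CHARACTERS: [Liu2021, Thm. 4.18] AS PRINTED at the good `μ` + «block = ⊥ at the bad `μ`»
# ⟹ the combined reading r8 `T.Thm418Combined res cmCl`

Cell pub-hodgecm2 (COR-CM), seat pin-3 (gen 10), 2026-08-23.  Theorems only; nothing landed is edited or restated.

The three Δ2 junctions of this lineage — the rank-one placement `thm418Combined_of_realised_rankOne'` (item6-p2, p307200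
`Item6PlacementJunctionTransport`), the summand-form App-C junction over the ported codes `thm418Combined_of_thm418AsPrintedC_summands_pkg`
(pin-3, p313477 `Item6PlacementJunctionAppendixCPkg`) and its X1-records form `thm418Combined_of_thm418AsPrintedC_summands_records`
(item6-p2, `Item6PlacementJunctionAppendixCRecords`) — ask their per-character data (`R μ`, the cite `hLiu μ`, `σ ∕ e ∕ he`, `J …` or `M ∕ jH ∕ hcm`,
`hnvD`, `hmultD`) at EVERY character `μ` with `τ' ∈ Φ_μ`.  At the pinned dictionary the index contains lines at which Liu's objects do
not exist (X3-Char item (F): compatible pair splittings carry no continuity; at a line whose finite Weil representation is NOT smooth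
the Weil-coinvariant block VANISHES, own-htheta ✔ `Transposition/Item6BlockVanishing` `block_ofTower_eq_bot_of_not_smooth`), and the
[Liu2021, Thm. 4.18] cite is honest only at the others.  This file re-cuts the three junctions over an arbitrary predicate
`Good : T.Char → Prop`: the per-character data are asked ONLY at the good characters, and at the bad ones the single hypothesis
`hbad : T.block μ = ⊥` (the clause of r8 is then vacuous — own-htheta's `BlockVanishing.thm418Combined_clause_of_block_eq_bot`,
re-derived inline so that this file's import closure stays inside the App-C junction lineage).

* `thm418Combined_of_realised_rankOne'_of_good` — datum level (any `G`, `Kof`, `T`);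
* `thm418Combined_of_thm418AsPrintedC_summands_pkg_of_good` — over the ported codes (`↥V.adelicFin`, `HodgeCM.Level.K`), p313477's
  binder list with `(hg : Good μ)` threaded through every per-`μ` family;
* `thm418Combined_of_thm418AsPrintedC_summands_records_of_good` — the same with the X1 binders as item6-p1's rational record
  `Map43RationalData` read into `T.H` by `jH`.

Use (pin level, port layers 67–72): `Good i :=` «the finite Weil representation of `line i` is smooth» (or `Continuous (line i).s`), `hbad`
from `block_ofTower_eq_bot_of_not_smooth`; at the good lines X3-Char item (E) (`Transposition/Item6CentralTypeAtPin[Index]`) supplies the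
weight-one character `μ_i` with `(line i).s = ι_{μ_i}`, `Φ_{μ_i} = (line i).lineType` for the rest `R i hi hg`.
HC_CM is NOT proved; no pin is discharged here; nothing about Liu's objects is constructed; «Δ2 BRIDGE CLOSED» is NOT claimed.
-/

set_option autoImplicit false

noncomputable section

open scoped DirectSum TensorProduct

namespace HodgeCM.Literature.Theta

namespace LiuAlbaneseModuleDatum

open Summit.HodgeConjecture.CorCM
open Literature.AlgebraicGeometry.ShimuraVarieties.UnitaryCanonicalModel
open Literature.NumberTheory.Automorphic.Liu2021 Literature.NumberTheory.Automorphic.Liu2021.AppendixC NumberField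
open MulAction

universe u v w

/-! ## §1 Datum level: the rank-one placement junction with inputs at the good characters only -/

/-- **THE PLACEMENT JUNCTION, rank-one branch, GOOD characters only**: as `thm418Combined_of_realised_rankOne'` (the inputs `hnv`,
`hmult`, `hreal` per `μ` with `τ' ∈ Φ_μ`) but asked only at the `μ` satisfying `Good μ`; at the others `block μ = ⊥` makes the clause
of r8 vacuous. [cite: Liu2021, Prop. 4.13, proof l. 2145; Def. 4.11; Thm. 4.18, Thm. 4.18 (1), (4.3)] -/
theorem thm418Combined_of_realised_rankOne'_of_good {G : Type} [Group G] {Lvl : Type v} [Preorder Lvl] [Nonempty Lvl]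
    {Kof : Lvl → Subgroup G} {T : LiuAlbaneseModuleDatum G Kof} {W : Lvl → Type w} [∀ K, AddCommGroup (W K)] [∀ K, Module ℂ (W K)]
    {res : ∀ K : Lvl, T.H →ₗ[ℂ] W K} {cmCl : ∀ K : Lvl, T.Char → Set (W K)}
    (Good : T.Char → Prop) (hbad : ∀ μ : T.Char, T.PhiMu μ → ¬ Good μ → T.block μ = ⊥)
    (h : ∀ μ : T.Char, T.PhiMu μ → Good μ →
      (∀ a : T.Adm μ, Nontrivial (T.Ω μ a)) ∧
      (∀ a : T.Adm μ, Module.rank ℂ (T.Ω μ a →ₗ[MonoidAlgebra ℂ G] T.H) ≤ 1) ∧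
      (∃ g : (⨁ a : T.Adm μ, T.Ω μ a) →ₗ[MonoidAlgebra ℂ G] T.H, Function.Injective g ∧
        ∃ K₀ : Lvl, ∀ K ≤ K₀, ∀ y, g y ∈ fixedBy (Kof K) T.H → res K (g y) ∈ Submodule.span ℂ (cmCl K μ))) :
    T.Thm418Combined res cmCl := by
  intro μ hΦ
  by_cases hg : Good μ
  · obtain ⟨hnv, hmult, g, hginj, K₀, hK⟩ := h μ hΦ hg
    refine ⟨K₀, fun K hKle x hx hfix => ?_⟩
    obtain ⟨y, rfl⟩ : x ∈ (LinearMap.range g).restrictScalars ℂ :=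
      block_le_range_of_rank_hom_le_one hnv hmult hginj hx
    exact hK K hKle y hfix
  · -- the clause of r8 is vacuous at a character with zero block (own-htheta `BlockVanishing` §0, inline)
    refine ⟨Classical.arbitrary Lvl, fun K _ x hx _ => ?_⟩
    rw [hbad μ hΦ hg, Submodule.mem_bot] at hx
    rw [hx, map_zero]
    exact Submodule.zero_mem _

/-! ## §2 Over the ported codes: p313477's binder list at the good characters -/

/-- **Δ2 IN ONE THEOREM, SUMMAND FORM, OVER THE PORTED CODES, GOOD CHARACTERS ONLY** — [Liu2021, Thm. 4.18] AS PRINTED at the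
Appendix-C datum (one `Thm418Rest` per GOOD character) + per-summand identifications + the proof's realisation + the D-side printed
sentences at the good characters, and `block μ = ⊥` at the bad ones ⟹ `T.Thm418Combined res cmCl` (= `LiuDictionary.Thm418C` at
`res := T'.res`, `cmCl := T'.cmClasses`).  KERNEL: per good `μ`, item6-p2's `rankOne_inputs_of_asPrinted_summands` at
`D := toThm418Data C (R μ hμ hg)` (group `↥V.adelicFin` by `rfl`) with the LEVEL binders discharged as in p313477
(`HodgeCM.Level.le_def`, `isOpen_K ∕ isCompact_K`, `pkgLevel_exists_K_le`); then §1.  HC_CM is NOT proved; no pin is discharged here.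
[cite: Liu2021, Thm. 4.18 (FJcycle.tex l. 2232–2245) with proof l. 2247–2268, Thm. 4.18 (1) (l. 2239), Lem. 2.4 (1) (l. 1210–1213), Prop. 4.13 proof l. 2145, Def. 4.11, App. D Lem. D.1 (1), §4.2 l. 2053–2074, App. C l. 4618–4624, Prop. C.5 (l. 4624–4637)]
[cite: Deligne1979ShimuraVarieties, 2.2.5 and Cor. 2.7.21] -/
theorem thm418Combined_of_thm418AsPrintedC_summands_pkg_of_good
    {L : HodgeCM.CMField} {ι₁ : L →+* ℂ} (V : HodgeCM.HermSpace3 L ι₁)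
    (h : exists_recordSystem) (Φ : Literature.AlgebraicGeometry.Motives.CMType L)
    {isotropicAt : ℕ → Prop}
    (C : Sec42Data (Model.honestP5Of h ⟨L.K⟩ ι₁ ⟨V.Hm, V.isHermitian, V.signature_ι₁, V.posDef_of_ne⟩ Φ) isotropicAt)
    (T : LiuAlbaneseModuleDatum ↥V.adelicFin (HodgeCM.Level.K : HodgeCM.Level V → Subgroup ↥V.adelicFin))
    {W : HodgeCM.Level V → Type w} [∀ K, AddCommGroup (W K)] [∀ K, Module ℂ (W K)]
    (res : ∀ K : HodgeCM.Level V, T.H →ₗ[ℂ] W K) (cmCl : ∀ K : HodgeCM.Level V, T.Char → Set (W K))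
    (Good : T.Char → Prop) (hbad : ∀ μ : T.Char, T.PhiMu μ → ¬ Good μ → T.block μ = ⊥)
    (R : ∀ μ : T.Char, T.PhiMu μ → Good μ → Thm418Rest C)
    (hLiu : ∀ (μ : T.Char) (hμ : T.PhiMu μ) (hg : Good μ), Thm418AsPrintedC C (R μ hμ hg))
    (σ : ∀ (μ : T.Char) (hμ : T.PhiMu μ) (hg : Good μ), T.Adm μ → (toThm418Data C (R μ hμ hg)).AdmIndex)
    (hσ : ∀ (μ : T.Char) (hμ : T.PhiMu μ) (hg : Good μ), Function.Injective (σ μ hμ hg))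
    (e : ∀ (μ : T.Char) (hμ : T.PhiMu μ) (hg : Good μ) (a : T.Adm μ),
      T.Ω μ a ≃ₗ[ℂ] (toThm418Data C (R μ hμ hg)).omegaAt (σ μ hμ hg a))
    (he : ∀ (μ : T.Char) (hμ : T.PhiMu μ) (hg : Good μ) (a : T.Adm μ) (g : ↥V.adelicFin) (m : T.Ω μ a),
      e μ hμ hg a (MonoidAlgebra.of ℂ ↥V.adelicFin g • m) = (toThm418Data C (R μ hμ hg)).rhoAt (σ μ hμ hg a) g (e μ hμ hg a m))
    (J : ∀ (μ : T.Char) (hμ : T.PhiMu μ) (hg : Good μ),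
      ℂ ⊗[fieldOfValues L (toThm418Data C (R μ hμ hg)).μ] (toThm418Data C (R μ hμ hg)).Ω →ₗ[ℂ] T.H)
    (hJinj : ∀ (μ : T.Char) (hμ : T.PhiMu μ) (hg : Good μ), Function.Injective (J μ hμ hg))
    (hJ : ∀ (μ : T.Char) (hμ : T.PhiMu μ) (hg : Good μ) (g : ↥V.adelicFin)
      (x : ℂ ⊗[fieldOfValues L (toThm418Data C (R μ hμ hg)).μ] (toThm418Data C (R μ hμ hg)).Ω),
      J μ hμ hg (((toThm418Data C (R μ hμ hg)).rhoΩ g).baseChange ℂ x) = MonoidAlgebra.of ℂ ↥V.adelicFin g • J μ hμ hg x)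
    (Dμ : ∀ (μ : T.Char) (hμ : T.PhiMu μ) (hg : Good μ), (toThm418Data C (R μ hμ hg)).Obj)
    (hpin : ∀ (μ : T.Char) (hμ : T.PhiMu μ) (hg : Good μ) (K : HodgeCM.Level V)
      (φ : (toThm418Data C (R μ hμ hg)).HomK K.K (Dμ μ hμ hg)),
      res K (J μ hμ hg ((1 : ℂ) ⊗ₜ[fieldOfValues L (toThm418Data C (R μ hμ hg)).μ]
        (toThm418Data C (R μ hμ hg)).res K.K (Dμ μ hμ hg) φ)) ∈ cmCl K μ)
    (hnvD : ∀ (μ : T.Char) (hμ : T.PhiMu μ) (hg : Good μ) (i : (toThm418Data C (R μ hμ hg)).AdmIndex),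
      Nontrivial ((toThm418Data C (R μ hμ hg)).omegaAt i))
    (hmultD : ∀ (μ : T.Char) (hμ : T.PhiMu μ) (hg : Good μ) (i : (toThm418Data C (R μ hμ hg)).AdmIndex),
      Module.rank ℂ (Representation.IntertwiningMap ((toThm418Data C (R μ hμ hg)).rhoAt i)
        (Representation.ofModule' (k := ℂ) (G := ↥V.adelicFin) T.H)) ≤ 1) :
    T.Thm418Combined res cmCl :=
  thm418Combined_of_realised_rankOne'_of_good Good hbad fun μ hμ hg =>
    rankOne_inputs_of_asPrinted_summands (toThm418Data C (R μ hμ hg)) (T := T) (hLiu μ hμ hg)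
      (fun _ _ hle => HodgeCM.Level.le_def.mp hle) (fun Γ => ⟨Γ.isOpen_K, Γ.isCompact_K⟩)
      (Transposition.pkgLevel_exists_K_le V) (σ μ hμ hg) (hσ μ hμ hg)
      (e μ hμ hg) (he μ hμ hg) (J μ hμ hg) (hJinj μ hμ hg) (hJ μ hμ hg) (Dμ μ hμ hg) (hpin μ hμ hg) (hnvD μ hμ hg) fun i => by
        letI : Module (MonoidAlgebra ℂ (toThm418Data C (R μ hμ hg)).G) T.H := T.instH₃
        haveI : IsScalarTower ℂ (MonoidAlgebra ℂ (toThm418Data C (R μ hμ hg)).G) T.H := T.instH₄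
        exact (Thm418Data.rank_linearMap_asModule_le_rank_intertwiningMap_ofModule' (H := T.H) i).trans (hmultD μ hμ hg i)


/-! ## §3 Over the ported codes with the X1 RECORDS: item6-p2's binder list at the good characters -/

/-- **Δ2 IN ONE THEOREM, SUMMAND FORM, OVER THE PORTED CODES AND THE X1 RECORDS, GOOD CHARACTERS ONLY** — as
`thm418Combined_of_thm418AsPrintedC_summands_records` (item6-p2) with every per-`μ` family asked only at the good characters and
`block μ = ⊥` at the bad ones.  KERNEL: the X1 binders `J ∕ hJ ∕ hJinj ∕ Dμ ∕ hpin` of §2 are THEOREMS over the rational record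
(`Map43RationalData.hJ ∕ injective_J ∕ J_tmul`, `finite_rat_L`) read through `jH`, exactly as in the records junction; then §2.
HC_CM is NOT proved; no pin is discharged here; nothing about Liu's objects is constructed.
[cite: Liu2021, Thm. 4.18 (FJcycle.tex l. 2232–2245) with proof l. 2247–2268 and map (4.3) l. 2250–2253, Thm. 4.18 (1) (l. 2239), Lem. 2.4 (1) (l. 1210–1213), Prop. 4.13 proof l. 2145, Def. 4.5 (2) (l. 1944–1952), Def. 4.11, App. D Lem. D.1 (1), §4.2 l. 2053–2081, App. C l. 4618–4624, Prop. C.5 (l. 4624–4637)]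
[cite: Deligne1979ShimuraVarieties, 2.2.5 and Cor. 2.7.21] -/
theorem thm418Combined_of_thm418AsPrintedC_summands_records_of_good
    {L : HodgeCM.CMField} {ι₁ : L →+* ℂ} (V : HodgeCM.HermSpace3 L ι₁)
    (h : exists_recordSystem) (Φ : Literature.AlgebraicGeometry.Motives.CMType L)
    {isotropicAt : ℕ → Prop}
    (C : Sec42Data (Model.honestP5Of h ⟨L.K⟩ ι₁ ⟨V.Hm, V.isHermitian, V.signature_ι₁, V.posDef_of_ne⟩ Φ) isotropicAt)
    (T : LiuAlbaneseModuleDatum ↥V.adelicFin (HodgeCM.Level.K : HodgeCM.Level V → Subgroup ↥V.adelicFin))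
    {W : HodgeCM.Level V → Type w} [∀ K, AddCommGroup (W K)] [∀ K, Module ℂ (W K)]
    (res : ∀ K : HodgeCM.Level V, T.H →ₗ[ℂ] W K) (cmCl : ∀ K : HodgeCM.Level V, T.Char → Set (W K))
    (Good : T.Char → Prop) (hbad : ∀ μ : T.Char, T.PhiMu μ → ¬ Good μ → T.block μ = ⊥)
    (R : ∀ μ : T.Char, T.PhiMu μ → Good μ → Thm418Rest C)
    (hLiu : ∀ (μ : T.Char) (hμ : T.PhiMu μ) (hg : Good μ), Thm418AsPrintedC C (R μ hμ hg))
    (σ : ∀ (μ : T.Char) (hμ : T.PhiMu μ) (hg : Good μ), T.Adm μ → (toThm418Data C (R μ hμ hg)).AdmIndex)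
    (hσ : ∀ (μ : T.Char) (hμ : T.PhiMu μ) (hg : Good μ), Function.Injective (σ μ hμ hg))
    (e : ∀ (μ : T.Char) (hμ : T.PhiMu μ) (hg : Good μ) (a : T.Adm μ),
      T.Ω μ a ≃ₗ[ℂ] (toThm418Data C (R μ hμ hg)).omegaAt (σ μ hμ hg a))
    (he : ∀ (μ : T.Char) (hμ : T.PhiMu μ) (hg : Good μ) (a : T.Adm μ) (g : ↥V.adelicFin) (m : T.Ω μ a),
      e μ hμ hg a (MonoidAlgebra.of ℂ ↥V.adelicFin g • m) = (toThm418Data C (R μ hμ hg)).rhoAt (σ μ hμ hg a) g (e μ hμ hg a m))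
    (M : ∀ (μ : T.Char) (hμ : T.PhiMu μ) (hg : Good μ), (toThm418Data C (R μ hμ hg)).Map43RationalData)
    (jH : ∀ (μ : T.Char) (hμ : T.PhiMu μ) (hg : Good μ), (M μ hμ hg).HB →ₗ[ℂ] T.H)
    (hjHinj : ∀ (μ : T.Char) (hμ : T.PhiMu μ) (hg : Good μ), Function.Injective (jH μ hμ hg))
    (hjH : ∀ (μ : T.Char) (hμ : T.PhiMu μ) (hg : Good μ) (g : ↥V.adelicFin) (x : (M μ hμ hg).HB),
      jH μ hμ hg ((M μ hμ hg).ρB g x) = MonoidAlgebra.of ℂ ↥V.adelicFin g • jH μ hμ hg x)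
    (hcm : ∀ (μ : T.Char) (hμ : T.PhiMu μ) (hg : Good μ) (K : HodgeCM.Level V)
      (φ : (toThm418Data C (R μ hμ hg)).HomK K.K (M μ hμ hg).Dμ),
      res K (jH μ hμ hg ((M μ hμ hg).ι
        (((M μ hμ hg).P ((toThm418Data C (R μ hμ hg)).res K.K (M μ hμ hg).Dμ φ)).baseChange ℂ (M μ hμ hg).α))) ∈ cmCl K μ)
    (hnvD : ∀ (μ : T.Char) (hμ : T.PhiMu μ) (hg : Good μ) (i : (toThm418Data C (R μ hμ hg)).AdmIndex),
      Nontrivial ((toThm418Data C (R μ hμ hg)).omegaAt i))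
    (hmultD : ∀ (μ : T.Char) (hμ : T.PhiMu μ) (hg : Good μ) (i : (toThm418Data C (R μ hμ hg)).AdmIndex),
      Module.rank ℂ (Representation.IntertwiningMap ((toThm418Data C (R μ hμ hg)).rhoAt i)
        (Representation.ofModule' (k := ℂ) (G := ↥V.adelicFin) T.H)) ≤ 1) :
    T.Thm418Combined res cmCl := by
  refine thm418Combined_of_thm418AsPrintedC_summands_pkg_of_good V h Φ C T res cmCl Good hbad R hLiu σ hσ e he
    (fun μ hμ hg => jH μ hμ hg ∘ₗ (M μ hμ hg).toMap43Data.J) ?_ ?_ (fun μ hμ hg => (M μ hμ hg).Dμ) ?_ hnvD hmultD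
  · -- (iii) «(4.3) is injective» (l. 2250–2268): a THEOREM over the rational record, then the injective reading `jH`
    intro μ hμ hg
    haveI := (M μ hμ hg).finite_rat_L
    exact (hjHinj μ hμ hg).comp (M μ hμ hg).injective_J
  · -- (ii) «`ℂ[𝔾(𝔸_F^∞)]`-linear» (l. 2250): `Map43RationalData.hJ`, then the equivariance of `jH`
    intro μ hμ hg g x
    show jH μ hμ hg ((M μ hμ hg).toMap43Data.J _) = _
    rw [(M μ hμ hg).hJ]
    exact hjH μ hμ hg g _
  · -- (C) the class identification THROUGH (4.3) at `z = 1` is the contract on Liu's own classes (`J_tmul`)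
    intro μ hμ hg K φ
    show res K (jH μ hμ hg ((M μ hμ hg).toMap43Data.J _)) ∈ _
    rw [(M μ hμ hg).J_tmul, one_smul]
    exact hcm μ hμ hg K φ

end LiuAlbaneseModuleDatum

end HodgeCM.Literature.Theta

end
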